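import Summits.HodgeConjecture.CorCM.MultiFieldWeilMerge
import HarnessLib

/-!
# COR-CM — MULTI-FIELD WEIL, part 6: the SINGLE-SLOT WEIL PARTS — `c` coordinates over `τ_s` and one layer of `K_m` of sign `s` span a line of
# algebraic classes on EVERY product of copies, GIVEN the Weil space of `B_m ⊞ E^c`

Cell `pub-hodgecm2` (COR-CM), seat b30 gen 28 (2026-08-23); count-neutral own lane MULTI-FIELD WEIL ENGINE; sequel of
`CorCM/MultiFieldWeilFresh.lean`; supplies the hypothesis `hpart` of the engine (`CorCM/MultiFieldWeilEngine.lean`) for ANY curve multiplicity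
`c`.  Theorems only (the bookkeeping definitions `δfam`, `mergeG`, `partSlots`, `partEmb` are in `CorCM/MultiFieldWeilMerge.lean`); no named fact,
no `sorry`.  The Weil space of
`⨁_i A(partSlots c m i) = B_m ⊞ E^c` with the diagonal action of `δ` enters as the HYPOTHESIS `hW` (Markman-type input, discharged per instance).

THE DEVICE (gen 18ʼs re-slotting, made uniform in `c`).  A single-slot part `W = C ⊔ L` of a weight of `X = ⨁_j A(κ j)` is NOT separated by
the slot projection to `Y = ⨁ A` when `c ≥ 2` (its `c` curve coordinates all lie over the ONE curve slot).  Re-present `X` over the PARTIALLY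
MERGED base family `A ∘ mergeG`, `mergeG : Fin (r+1+c) → Fin (r+1)` (`r+1` original slots followed by `c` marked curve slots), through a slot map
`κ'` sending the `c` curve factors carrying `C` to the marked slots (`mergeG ∘ κ' = κ`, so `X` is LITERALLY `⨁_j (A ∘ mergeG)(κ' j)` after
substitution); then `W` IS separated, its projection lies on the sub-product along `partEmb : Fin (c+1) ↪ Fin (r+1+c)` (the slot of `B_m` and
the marked slots), where it has constant eigenvalue `s · i√d` under `δ` (`apply_eq_of_signG`), hence lies in a Weil eigenline
(`PairWeights.weightClassesAlg_le_weilClassesPlus/Minus`) of `⨁_i A(partSlots c m i)`, algebraic by `hW`; pull back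
(`CMWeights.weightClassesAlg_map_le_algebraicClasses`) and lift along `κ'` (distribution lemma `CMWeights.weightClassesAlg_comp_le_algebraicClasses_of_injOn`).

* §2 `weightClassesAlg_le_algebraicClasses_of_part_merged` (the merged form),
  `…_of_part_of_factor` (the factored form); §3 **`weightClassesAlg_le_algebraicClasses_of_partG`** (any slot map; the engineʼs `hpart`).
HONEST FRAMING: nothing about the Hodge conjecture is concluded here; `HC_CM` is not asserted.
[cite: Deligne1982HodgeCycles, §5 (c)] [cite: vanGeemen1994HodgeAV, 4.9] [cite: Milne2020HodgeClassesAV, 1.2 (a) and Thm. 1]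
[cite: MoonenZarhin1995Duke, Thm. 2.4]

## References
* [Deligne1982HodgeCycles] P. Deligne, LNM 900 (1982), §5 (c).  [vanGeemen1994HodgeAV] B. van Geemen, LNM 1594 (1994), 3.6–3.7, 4.9.
  [Milne2020HodgeClassesAV] J. S. Milne, arXiv:2010.08857, 1.2 (a), Thm. 1.  [MoonenZarhin1995Duke] B. Moonen, Yu. Zarhin, Duke Math.
  J. 77 (1995), Thm. 2.4.
-/

noncomputable section

open CategoryTheory CategoryTheory.Limits NumberField

namespace Summit.HodgeConjecture.CorCM.MultiFieldWeil

open Literature.AlgebraicGeometry Literature.AlgebraicGeometry.Motives Literature.AlgebraicGeometry.HodgeTheory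
open Literature.AlgebraicGeometry.ComplexMultiplication (IsCMTypeRealisation)
open Literature.AlgebraicGeometry.Pohlmann1968
open Literature.AlgebraicTopology.SingularHomology
open Literature.NumberTheory.ComplexMultiplication
open Summit.HodgeConjecture.CorCM.Census.MultiFieldWeil
open Summit.HodgeConjecture.CorCM.CMWeights (weightClassesAlg_comp_le_algebraicClasses_of_injOn weightClassesAlg_map_le_algebraicClasses
  sigma_map_injective)
open Summit.HodgeConjecture.CorCM.PairWeights

open scoped Classical Pointwise

/-! ## §2 The merged and the factored forms -/

section Factored

variable {I : Type} {r : ℕ} {Kf : I → Type} [∀ i, Field (Kf i)] [∀ i, NumberField (Kf i)] {i₀ : I} {is : Fin r → I} {n : Fin r → ℕ}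
  {e : ∀ m : Fin r, (Kf (is m) →+* ℂ) ≃ Fin (n m) × Bool} {τ : Kf i₀ →+* ℂ} {im : ∀ m : Fin r, Kf i₀ →+* Kf (is m)}
  (hk : ∀ σ : Kf i₀ →+* ℂ, σ = τ ∨ σ = ComplexEmbedding.conjugate τ)
  (he_sign : ∀ (m : Fin r) (s : Kf (is m) →+* ℂ), (e m s).2 = true ↔ s.comp (im m) = τ)
  {A : Fin (r + 1) → AbelianVariety ℂ} {Φ : ∀ j : Fin (r + 1), CMType (Kf (mfSlots i₀ is j))}
  {ι : ∀ j, 𝓞 (Kf (mfSlots i₀ is j)) →+* End (A j)}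
  {θ : ∀ j, Kf (mfSlots i₀ is j) →+* Module.End ℂ (complexBetti (A j).X 1)}
  (hA : ∀ j, IsCMTypeRealisation (Φ j) (A j) (ι j) (θ j))
  {δ : 𝓞 (Kf i₀)} {d : ℕ} (hτ : τ (δ : Kf i₀) = Complex.I * (Real.sqrt d : ℂ))

omit [∀ i, NumberField (Kf i)] in
/-- Transport of the Weil-space hypothesis along an equality of slot families. [folklore] -/
theorem weilHyp_transport {c w : ℕ} {f₁ f₂ : Fin (c + 1) → Fin (r + 1)} (h : f₁ = f₂)
    (hW : weilClassesOf (⨁ fun i => A (f₁ i)) (biproduct.map fun i => ι (f₁ i) (δfam im δ (f₁ i))) w d ≤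
      algebraicClasses (⨁ fun i => A (f₁ i)).X w) :
    weilClassesOf (⨁ fun i => A (f₂ i)) (biproduct.map fun i => ι (f₂ i) (δfam im δ (f₂ i))) w d ≤
      algebraicClasses (⨁ fun i => A (f₂ i)).X w := by
  subst h
  exact hW

include hk he_sign hA hτ in
/-- **Merged form.**  For `κ' : Fin N → Fin (r+1+c)`, a weight `G` of `X = ⨁_j A(mergeG (κ' j))` of size `2w` which is separated by the projection
`(j, s) ↦ (κ' j, s)`, whose slots under `κ'` lie in the range of `partEmb`, and all of whose points have sign `s`, spans a line of algebraic
classes, GIVEN the Weil space of `⨁_i A(partSlots c m i)`. [cite: vanGeemen1994HodgeAV, 4.9] [cite: Milne2020HodgeClassesAV, 1.2 (a) and Thm. 1] -/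
theorem weightClassesAlg_le_algebraicClasses_of_part_merged (c : ℕ) (m : Fin r) {w : ℕ}
    (hW : weilClassesOf (⨁ fun i => A (partSlots c m i)) (biproduct.map fun i => ι (partSlots c m i) (δfam im δ (partSlots c m i))) w d ≤
      algebraicClasses (⨁ fun i => A (partSlots c m i)).X w)
    {N : ℕ} (κ' : Fin N → Fin (r + 1 + c)) {s : Bool} {G : Finset (Crd Kf i₀ is (fun j => mergeG r c (κ' j)))}
    (hinj : Set.InjOn (Sigma.map κ' (fun _ => id) : Crd Kf i₀ is (fun j => mergeG r c (κ' j)) →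
      ((l : Fin (r + 1 + c)) × (Kf (mfSlots i₀ is (mergeG r c l)) →+* ℂ))) ↑G)
    (hrange : ∀ x ∈ G, κ' x.1 ∈ Set.range (partEmb r c m))
    (hsign : ∀ x ∈ G, vG e τ (fun j => mergeG r c (κ' j)) x = Sum.inl s ∨
      ∃ a : Fin (n m), vG e τ (fun j => mergeG r c (κ' j)) x = Sum.inr ⟨m, (a, s)⟩)
    (hcard : G.card = 2 * w) :
    weightClassesAlg (fun j => A (mergeG r c (κ' j))) (fun j => ι (mergeG r c (κ' j))) (2 * w) G ≤
      algebraicClasses (⨁ fun j => A (mergeG r c (κ' j))).X w := by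
  have hA' : ∀ l : Fin (r + 1 + c), IsCMTypeRealisation (Φ (mergeG r c l)) (A (mergeG r c l)) (ι (mergeG r c l)) (θ (mergeG r c l)) :=
    fun l => hA (mergeG r c l)
  set P' : Crd Kf i₀ is (fun j => mergeG r c (κ' j)) → ((l : Fin (r + 1 + c)) × (Kf (mfSlots i₀ is (mergeG r c l)) →+* ℂ)) :=
    Sigma.map κ' (fun _ => id) with hP'
  set TY := G.image P' with hTY
  have hTYcard : TY.card = 2 * w := by rw [hTY, Finset.card_image_of_injOn hinj, hcard]
  have hTYslot : ∀ z ∈ TY, z.1 ∈ Set.range (partEmb r c m) := by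
    intro z hz
    obtain ⟨x, hx, rfl⟩ := Finset.mem_image.1 hz
    exact hrange x hx
  obtain ⟨S'', hS''T, hS''mem⟩ := exists_map_sigma_eq_fin (K := fun l => Kf (mfSlots i₀ is (mergeG r c l))) (partEmb r c m)
    (partEmb_injective c m) TY hTYslot
  have hcardS'' : S''.card = 2 * w := by rw [← hS''T, Finset.card_map] at hTYcard; exact hTYcard
  -- eigenvalues on the sub-product
  let a' : ∀ i : Fin (c + 1), 𝓞 (Kf (mfSlots i₀ is (mergeG r c (partEmb r c m i)))) := fun i => δfam im δ (mergeG r c (partEmb r c m i))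
  have hval : ∀ z ∈ S'', z.2 ((a' z.1 : 𝓞 (Kf (mfSlots i₀ is (mergeG r c (partEmb r c m z.1))))) :
      Kf (mfSlots i₀ is (mergeG r c (partEmb r c m z.1)))) = if s then Complex.I * (Real.sqrt d : ℂ) else -(Complex.I * (Real.sqrt d : ℂ)) := by
    intro z hz
    have hzT := (hS''mem z).1 hz
    obtain ⟨x, hx, hxz⟩ := Finset.mem_image.1 hzT
    have hsx := hsign x hx
    have hvx : vG e τ (fun j => mergeG r c (κ' j)) x = toPtG e τ ⟨mergeG r c (partEmb r c m z.1), z.2⟩ := by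
      have h := congrArg (fun q : (l : Fin (r + 1 + c)) × (Kf (mfSlots i₀ is (mergeG r c l)) →+* ℂ) =>
        toPtG e τ (⟨mergeG r c q.1, q.2⟩ : (j : Fin (r + 1)) × (Kf (mfSlots i₀ is j) →+* ℂ))) hxz
      exact h
    rw [hvx] at hsx
    exact apply_eq_of_signG hk he_sign hτ ⟨mergeG r c (partEmb r c m z.1), z.2⟩ s (by
      rcases hsx with h | ⟨a, h⟩
      · exact Or.inl h
      · exact Or.inr ⟨m, a, h⟩)
  -- the Weil space of the sub-product, algebraic by `hW`
  have hWsub : weilClassesOf (⨁ fun i => A (mergeG r c (partEmb r c m i)))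
      (biproduct.map fun i => ι (mergeG r c (partEmb r c m i)) (a' i)) w d ≤
      algebraicClasses (⨁ fun i => A (mergeG r c (partEmb r c m i))).X w :=
    weilHyp_transport (mergeG_partEmb c m).symm hW
  have halg'' : weightClassesAlg (K := fun i => Kf (mfSlots i₀ is (mergeG r c (partEmb r c m i))))
      (fun i => A (mergeG r c (partEmb r c m i))) (fun i => ι (mergeG r c (partEmb r c m i))) (2 * w) S'' ≤
      algebraicClasses (⨁ fun i => A (mergeG r c (partEmb r c m i))).X w := by
    cases s
    · refine (weightClassesAlg_le_weilClassesMinus (K := fun i => Kf (mfSlots i₀ is (mergeG r c (partEmb r c m i))))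
        (A := fun i => A (mergeG r c (partEmb r c m i))) (ι := fun i => ι (mergeG r c (partEmb r c m i))) a' hcardS''
        fun z hz => ?_).trans ((weilClassesMinus_le_weilClassesOf _ _ w d).trans hWsub)
      simpa using hval z hz
    · refine (weightClassesAlg_le_weilClassesPlus (K := fun i => Kf (mfSlots i₀ is (mergeG r c (partEmb r c m i))))
        (A := fun i => A (mergeG r c (partEmb r c m i))) (ι := fun i => ι (mergeG r c (partEmb r c m i))) a' hcardS''
        fun z hz => ?_).trans ((weilClassesPlus_le_weilClassesOf _ _ w d).trans hWsub)
      simpa using hval z hz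
  have hYalg : weightClassesAlg (fun l => A (mergeG r c l)) (fun l => ι (mergeG r c l)) (2 * w) TY ≤
      algebraicClasses (⨁ fun l => A (mergeG r c l)).X w := by
    rw [← hS''T]
    exact weightClassesAlg_map_le_algebraicClasses hA' (partEmb r c m) (partEmb_injective c m) hcardS'' halg''
  exact weightClassesAlg_comp_le_algebraicClasses_of_injOn (K := fun l => Kf (mfSlots i₀ is (mergeG r c l))) hA' κ' hcard hinj hYalg

include hk he_sign hA hτ in
/-- **Factored form.**  For `κ : Fin N → Fin (r+1)` FACTORED as `κ = mergeG ∘ κ'` (so that `X = ⨁_j A(κ j)` is LITERALLY the merged product),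
a weight `G` of `X` of size `2w` whose points of equal `κ'`-slot and equal model image coincide, whose `κ'`-slots lie in the range of `partEmb`,
and all of whose points have sign `s`, spans a line of algebraic classes, GIVEN the Weil space of `⨁_i A(partSlots c m i)`.
[cite: vanGeemen1994HodgeAV, 4.9] [cite: Milne2020HodgeClassesAV, 1.2 (a) and Thm. 1] -/
theorem weightClassesAlg_le_algebraicClasses_of_part_of_factor (c : ℕ) (m : Fin r) {w : ℕ}
    (hW : weilClassesOf (⨁ fun i => A (partSlots c m i)) (biproduct.map fun i => ι (partSlots c m i) (δfam im δ (partSlots c m i))) w d ≤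
      algebraicClasses (⨁ fun i => A (partSlots c m i)).X w)
    {N : ℕ} (κ : Fin N → Fin (r + 1)) (κ' : Fin N → Fin (r + 1 + c)) (hκ : ∀ j, mergeG r c (κ' j) = κ j)
    {s : Bool} {G : Finset (Crd Kf i₀ is κ)}
    (hsep : ∀ x ∈ G, ∀ x' ∈ G, κ' x.1 = κ' x'.1 → vG e τ κ x = vG e τ κ x' → x = x')
    (hrange : ∀ x ∈ G, κ' x.1 ∈ Set.range (partEmb r c m))
    (hsign : ∀ x ∈ G, vG e τ κ x = Sum.inl s ∨ ∃ a : Fin (n m), vG e τ κ x = Sum.inr ⟨m, (a, s)⟩)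
    (hcard : G.card = 2 * w) :
    weightClassesAlg (fun j => A (κ j)) (fun j => ι (κ j)) (2 * w) G ≤ algebraicClasses (⨁ fun j => A (κ j)).X w := by
  -- `X` is literally the merged product
  obtain rfl : κ = fun j => mergeG r c (κ' j) := funext fun j => (hκ j).symm
  refine weightClassesAlg_le_algebraicClasses_of_part_merged hk he_sign hA hτ c m hW κ' ?_ hrange hsign hcard
  -- separation
  intro x hx x' hx' hxx'
  have hfst : κ' x.1 = κ' x'.1 := congrArg Sigma.fst hxx'
  have hvv : vG e τ (fun j => mergeG r c (κ' j)) x = vG e τ (fun j => mergeG r c (κ' j)) x' := by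
    have h := congrArg (fun q : (l : Fin (r + 1 + c)) × (Kf (mfSlots i₀ is (mergeG r c l)) →+* ℂ) =>
      toPtG e τ (⟨mergeG r c q.1, q.2⟩ : (j : Fin (r + 1)) × (Kf (mfSlots i₀ is j) →+* ℂ))) hxx'
    exact h
  exact hsep x hx x' hx' hfst hvv

end Factored

/-! ## §3 The single-slot parts of every product of copies -/

section Part

variable {I : Type} {r : ℕ} {Kf : I → Type} [∀ i, Field (Kf i)] [∀ i, NumberField (Kf i)] {i₀ : I} {is : Fin r → I} {n : Fin r → ℕ}
  {e : ∀ m : Fin r, (Kf (is m) →+* ℂ) ≃ Fin (n m) × Bool} {τ : Kf i₀ →+* ℂ} {im : ∀ m : Fin r, Kf i₀ →+* Kf (is m)}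
  (hττ : ComplexEmbedding.conjugate τ ≠ τ) (hk : ∀ σ : Kf i₀ →+* ℂ, σ = τ ∨ σ = ComplexEmbedding.conjugate τ)
  (he_sign : ∀ (m : Fin r) (s : Kf (is m) →+* ℂ), (e m s).2 = true ↔ s.comp (im m) = τ)
  {A : Fin (r + 1) → AbelianVariety ℂ} {Φ : ∀ j : Fin (r + 1), CMType (Kf (mfSlots i₀ is j))}
  {ι : ∀ j, 𝓞 (Kf (mfSlots i₀ is j)) →+* End (A j)}
  {θ : ∀ j, Kf (mfSlots i₀ is j) →+* Module.End ℂ (complexBetti (A j).X 1)}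
  (hA : ∀ j, IsCMTypeRealisation (Φ j) (A j) (ι j) (θ j))
  {δ : 𝓞 (Kf i₀)} {d : ℕ} (hτ : τ (δ : Kf i₀) = Complex.I * (Real.sqrt d : ℂ))

omit [∀ i, NumberField (Kf i)] in
include hττ hk in
/-- **Coordinates over the same curve label sit on different factors.** [folklore] -/
theorem injOn_fst_of_vG_eq_inl {N : ℕ} (κ : Fin N → Fin (r + 1)) {s : Bool} {C : Finset (Crd Kf i₀ is κ)}
    (hCv : ∀ x ∈ C, vG e τ κ x = Sum.inl s) : Set.InjOn (fun x : Crd Kf i₀ is κ => x.1) ↑C := by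
  intro x hx x' hx' h
  have hv : vG e τ κ x = vG e τ κ x' := by rw [hCv x hx, hCv x' hx']
  obtain ⟨j, σ⟩ := x
  obtain ⟨j', σ'⟩ := x'
  dsimp only at h
  subst h
  have h2 := toPtG_injective hττ hk hv
  simp only [Sigma.mk.inj_iff, heq_eq_eq, true_and] at h2
  rw [h2]

include hττ hk he_sign hA hτ in
/-- **THE SINGLE-SLOT WEIL PARTS HAVE ALGEBRAIC LINES (any slot map, any curve multiplicity).**  On `X = ⨁_j A(κ j)`, a weight `C ⊔ L` with `C` =
`c` coordinates over `τ_s` and `L` a layer of `K_m` of sign `s` spans `H^{2w}(X)_{C ⊔ L} ⊆ Nʷ H^{2w}(X)` (`n_m + c = 2w`), GIVEN the Weil space of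
`⨁_i A(partSlots c m i) = B_m ⊞ E^c` — the hypothesis `hpart` of the engine.  Re-slot the `c` curve factors carrying `C` to the marked slots
(`κ'`), then the factored form. [cite: vanGeemen1994HodgeAV, 4.9] [cite: Milne2020HodgeClassesAV, 1.2 (a) and Thm. 1]
[cite: MoonenZarhin1995Duke, Thm. 2.4] -/
theorem weightClassesAlg_le_algebraicClasses_of_partG (c : ℕ) (m : Fin r) {w : ℕ} (hw : n m + c = 2 * w)
    (hW : weilClassesOf (⨁ fun i => A (partSlots c m i)) (biproduct.map fun i => ι (partSlots c m i) (δfam im δ (partSlots c m i))) w d ≤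
      algebraicClasses (⨁ fun i => A (partSlots c m i)).X w)
    {N : ℕ} (κ : Fin N → Fin (r + 1)) {s : Bool} (C L : Finset (Crd Kf i₀ is κ)) (hCL : Disjoint C L) (hC : C.card = c)
    (hCv : ∀ x ∈ C, vG e τ κ x = Sum.inl s) (hL : IsLayerG (vG e τ κ) m s L) :
    weightClassesAlg (fun j => A (κ j)) (fun j => ι (κ j)) (2 * w) (C ∪ L) ≤ algebraicClasses (⨁ fun j => A (κ j)).X w := by
  -- the curve factors carrying `C`, numbered
  have hCinj : Set.InjOn (fun x : Crd Kf i₀ is κ => x.1) ↑C := injOn_fst_of_vG_eq_inl hττ hk κ hCv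
  set JC : Finset (Fin N) := C.image Sigma.fst with hJC
  have hJCcard : JC.card = c := by rw [hJC, Finset.card_image_of_injOn hCinj, hC]
  let idx : JC → Fin c := fun j => Fin.cast hJCcard (JC.equivFin j)
  have hidx : Function.Injective idx := fun j j' h => JC.equivFin.injective (Fin.cast_injective _ h)
  -- curve factors carrying `C` are curve slots; layer points are on the slot of `B_m`
  have hκC : ∀ x ∈ C, κ x.1 = 0 := fun x hx => fst_eq_zero_of_toPtG_eq_inl e τ (hCv x hx)
  have hκL : ∀ x ∈ L, κ x.1 = m.succ := by
    intro x hx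
    obtain ⟨a, ha⟩ := hL.mem_cases hx
    exact fst_eq_succ_of_toPtG_eq_inr e τ ha
  have hLJC : ∀ x ∈ L, x.1 ∉ JC := by
    intro x hx hj
    obtain ⟨y, hy, hyx⟩ := Finset.mem_image.1 hj
    have h0 := hκC y hy
    rw [hyx, hκL x hx] at h0
    exact Fin.succ_ne_zero m h0
  -- the re-slotting
  let κ' : Fin N → Fin (r + 1 + c) := fun j =>
    if h : j ∈ JC then Fin.natAdd (r + 1) (idx ⟨j, h⟩) else Fin.castAdd c (κ j)
  have hκ'C : ∀ x (hx : x ∈ C), κ' x.1 = Fin.natAdd (r + 1) (idx ⟨x.1, Finset.mem_image_of_mem _ hx⟩) := fun x hx => by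
    show (if h : x.1 ∈ JC then Fin.natAdd (r + 1) (idx ⟨x.1, h⟩) else Fin.castAdd c (κ x.1)) = _
    rw [dif_pos (Finset.mem_image_of_mem _ hx)]
  have hκ'L : ∀ x ∈ L, κ' x.1 = Fin.castAdd c m.succ := fun x hx => by
    show (if h : x.1 ∈ JC then Fin.natAdd (r + 1) (idx ⟨x.1, h⟩) else Fin.castAdd c (κ x.1)) = _
    rw [dif_neg (hLJC x hx), hκL x hx]
  have hκ : ∀ j, mergeG r c (κ' j) = κ j := by
    intro j
    show mergeG r c (if h : j ∈ JC then Fin.natAdd (r + 1) (idx ⟨j, h⟩) else Fin.castAdd c (κ j)) = κ j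
    by_cases h : j ∈ JC
    · obtain ⟨y, hy, hyj⟩ := Finset.mem_image.1 h
      rw [dif_pos h, mergeG_natAdd, ← hyj, hκC y hy]
    · rw [dif_neg h, mergeG_castAdd]
  refine weightClassesAlg_le_algebraicClasses_of_part_of_factor hk he_sign hA hτ c m hW κ κ' hκ (s := s) ?_ ?_ ?_ ?_
  · -- separation
    intro x hx x' hx' hfst hv
    rcases Finset.mem_union.1 hx with hxC | hxL <;> rcases Finset.mem_union.1 hx' with hxC' | hxL'
    · have h := hfst
      rw [hκ'C x hxC, hκ'C x' hxC', Fin.natAdd_inj] at h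
      have hj : x.1 = x'.1 := congrArg Subtype.val (hidx h)
      exact hCinj hxC hxC' hj
    · rw [hCv x hxC] at hv
      obtain ⟨a, ha⟩ := hL.mem_cases hxL'
      rw [ha] at hv
      exact absurd hv Sum.inl_ne_inr
    · rw [hCv x' hxC'] at hv
      obtain ⟨a, ha⟩ := hL.mem_cases hxL
      rw [ha] at hv
      exact absurd hv Sum.inr_ne_inl
    · exact hL.injOn hxL hxL' hv
  · -- slots in the range of `partEmb`
    intro x hx
    rcases Finset.mem_union.1 hx with hxC | hxL
    · exact ⟨(idx ⟨x.1, Finset.mem_image_of_mem _ hxC⟩).succ, by rw [partEmb_succ, hκ'C x hxC]⟩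
    · exact ⟨0, by rw [partEmb_zero, hκ'L x hxL]⟩
  · -- signs
    intro x hx
    rcases Finset.mem_union.1 hx with hxC | hxL
    · exact Or.inl (hCv x hxC)
    · exact Or.inr (hL.mem_cases hxL)
  · rw [Finset.card_union_of_disjoint hCL, hC, hL.1, ← hw, add_comm]

end Part

end Summit.HodgeConjecture.CorCM.MultiFieldWeil

end
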